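import Summits.AtomisticToContinuum.Crystallization.Theorems.PricedLinkCensusChargedPeriodicIsOptimal

/-!
# `ChargedPeriodicIsOptimal` (stmt-AtomisticToContinuum-2913): the energetic conjunct for a charged `Q`

Corollary of item 2913 for the assemblies that use it: if some periodic configuration `Q` of
`ℝ³` is charged with positive density at every scale by a sequence of Lennard-Jones ground
states, then `Q` realises the minimum of the energy per particle over periodic configurations
AND `E(N)/N → e(Q)` — i.e. `HasPeriodicGroundStateEnergy lennardJones 3` holds with witness `Q`
(`chargedPeriodicIsOptimal_proof` with the tree's `crysEnergyLimit` and `IsLeast.csInf_eq`).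
All `[folklore]`.
-/

noncomputable section

namespace Summit.AtomisticToContinuum.Crystallization.Theorems.ChargedPeriodicOptimal

open Literature.MathematicalPhysics.StatisticalMechanics
open Summit.AtomisticToContinuum.Crystallization.Theorems.ChargedEnergyGapNegative
open Filter Topology

/-- **A charged periodic configuration realises the periodic ground-state energy**: under the
charging hypothesis of item 2913, `IsLeast (range e) (e Q)` and `E(N)/N → e(Q)`, hence
`HasPeriodicGroundStateEnergy lennardJones 3`. [folklore] -/
theorem hasPeriodicGroundStateEnergy_of_charged (Q : PeriodicConfiguration 3)
    (hQ : ∃ x : (N : ℕ) → (Fin N → EuclideanSpace ℝ (Fin 3)),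
      (∀ N, IsGroundState lennardJones (x N)) ∧ ∀ R ε : ℝ, 0 < R → 0 < ε → ∃ ρ : ℝ, 0 < ρ ∧
        ∃ᶠ N : ℕ in atTop, ρ * (N : ℝ) ≤ (Nat.card {i : Fin N //
          ∃ A : EuclideanSpace ℝ (Fin 3) →ₗᵢ[ℝ] EuclideanSpace ℝ (Fin 3), ∃ q ∈ Q.points,
            (∀ s ∈ Q.points, dist s q ≤ R → ∃ j : Fin N, dist (x N j) (x N i + A (s - q)) ≤ ε) ∧
            (∀ j : Fin N, dist (x N j) (x N i) ≤ R →
              ∃ s ∈ Q.points, dist (x N j) (x N i + A (s - q)) ≤ ε)} : ℝ)) :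
    IsLeast (Set.range fun Q' : PeriodicConfiguration 3 => Q'.energyPerParticle lennardJones)
        (Q.energyPerParticle lennardJones) ∧
      Tendsto (fun N : ℕ => groundStateEnergy lennardJones 3 N / N) atTop
        (𝓝 (Q.energyPerParticle lennardJones)) ∧
      HasPeriodicGroundStateEnergy lennardJones 3 := by
  have hleast := Summit.AtomisticToContinuum.Crystallization.Theorems.chargedPeriodicIsOptimal_proof
    Q hQ
  have hlim : Tendsto (fun N : ℕ => groundStateEnergy lennardJones 3 N / N) atTop
      (𝓝 (Q.energyPerParticle lennardJones)) := by
    have h := crysEnergyLimit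
    have h2 : (⨅ Q' : PeriodicConfiguration 3, Q'.energyPerParticle lennardJones) =
        Q.energyPerParticle lennardJones := hleast.csInf_eq
    rwa [h2] at h
  exact ⟨hleast, hlim, Q, hleast, hlim⟩

end Summit.AtomisticToContinuum.Crystallization.Theorems.ChargedPeriodicOptimal

end
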